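import Summits.BirchSwinnertonDyer.BirchSwinnertonDyer.Theorems.ErratumRoadFiveNonSurjCornerHybridChaKernel
import Summits.BirchSwinnertonDyer.BirchSwinnertonDyer.Theorems.ErratumRoadFiveNonSurjCornerEulerHalfCornerPAnchor
import HarnessLib

/-!
# Route `ErratumRoadFive` (rung K2), crux `NonSurjCorner` (item stmt-BirchSwinnertonDyer-19065), registered line `Lines/hybrid.lean`:
# GLUE #17 — THE STRUCTURAL RESIDUAL DISSOLVES. glue #16 with the residual binder (slot 7) and the level-lowering pair (slot 5 conjunct 3) DELETED:
# on the corner `p` is multiplicative, so every multi-carrier pair has an even Shimura set `S ∋ p` (parity only), and the p-ANCHOR (bsd-idea-9 g4 ∕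
# idea-crit-14; lead's `PAnchor`) supplies the degree identity with NO datum — the Euler-system half holds at EVERY multi-carrier corner pair
# (cell `bsd-stepL`, seat `bsd-stepL-corner-p1` g17; `--supports stmt-BirchSwinnertonDyer-19065 --as helper`; RULING 62)

WHY THIS FILE. Glues #3–#16 all carried a structural residual: the corner pairs whose split carriers admit no Papikian–Rabinoff pairing half (r3 «three
split primes ≠ p» → r14 «three split primes ≠ p, all ≡ 1 (mod p), off the genus-zero additive loci»). The residual existed ONLY to supply the (DEG) datum
of the Shimura roads. The p-anchor (Pasten's Lemma 6.18 AT `q = p ∈ S` ⟹ every cokernel of the level is a `p`-adic unit ⟹ (DEG) for every even `S ∋ p`;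
`EulerHalfPAnchor.PAnchor.padicValNat_delta_empty_eq_of_self_mem`, p629458) removes that datum on every frame with `p ∈ S` — and on crux 19065 `p` IS
multiplicative (`ClassX11b`), so such frames exist at every pair. This seat rebuilt the corner's §2 on datum-free IMAGE-FREE cores (the lead's datum-free
cores p630432 ∕ p630457 carry `Surj W p`): `…EulerHalfInertPAnchorOfTwinLower` (inert core), `…EulerHalfSavedPAnchorOfTwinLowerD` (D-core), and
`…EulerHalfCornerPAnchor` (corner roads + the PARITY datum `NonSurjCorner.inertSet_or_upToOne_of_multiCarrier` + the composition
`NonSurjCorner.missingUpperBoundAt_of_savedDisplayD_of_twinLower_pAnchor` — NO residual hypothesis). THIS FILE = glue #16 with `hres3oneModOffGenusZero`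
and `hLLOS` DELETED and the §2 branch replaced by that composition:
* **glue #17 `nonSurjCorner_of_kolyZShaAn_of_twinMuAn_of_fifteenFacts_of_hidaFacts_of_fiveNamedInputs_of_carrierLabelsB6_pAnchor`**.
Candidate composition of `Lines/hybrid.lean` r15: SIX stubs {`stub_kolyZShaAnDeep57`, `stub_twinMuAn57` (19948), `stub_twinFactsFifteen57`,
`stub_hidaTwinFacts57`, `stub_cornerShimuraFacts57` (3 + 5, conjunct 3 gone), `stub_shimuraCarrierLabelsB6_57`} — NO structural residual.
CENSUS: unchanged numerically (the residual had 0 known pairs at 5 and 7); class-wide the Euler-system half of EVERY multi-carrier corner pair is now in the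
cone of {published inputs, 19948's twins' lower half via Hida, the (B6)@carriers object}.

HONEST FRAMING: ONE THEOREM (no definition, no named fact, no `sorry`); CONDITIONAL on every displayed binder (fifteen + six + three + five named facts,
`PastenShimura2024_componentOrders` now consumed WITH Lemma 6.18 at `q = p` — RULING 60 (a): provenance confirmed; 19948; the (B6)@carriers labelled family;
the deep Kolyvagin certificates); item 19065 is NOT closed; no stub is discharged as a stub (a structural stub becomes UNNECESSARY and leaves the line);
nothing about any curve's BSD; BSD is not advanced; T7. Credit: bsd-idea-9 g4 + idea-crit-14 (the p-anchor), bsd-line-er5-p1 g1 (`PAnchor` in Theorems),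
planner g41 (RULING 60∕62), lane B corner3-p2 (cores, Cha kernel), bsd-line-er5-p1-w2 (Lemma 6.18 typing), and the credits of glue #16.
References (locators only): [cite: PastenShimura2024, Prop. 6.13, §6.6, Lemmas 6.15, 6.16 and 6.18] [cite: RibetTakahashi1997, Thm. 1] [cite: PapikianRabinoff2016, Cor. 3.5]
[cite: Jetchev2008, Thm. 1.1, Cor. 1.5] [cite: Cha2005, Thm. 21 and Rmk. 25] [cite: Kato2004Asterisque, §17.13] [cite: EmertonPollackWeston2006, Thm. 5.1.3]
[cite: MilneADT2006, Ch. I Prop. 3.8] [cite: Miller2011LMS, Def. 1.1].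
-/

set_option autoImplicit false
set_option linter.dupNamespace false -- `Summit.BirchSwinnertonDyer.BirchSwinnertonDyer` (summit = problem), tree-wide

noncomputable section

open scoped Classical NumberField MatrixGroups ModularForm

namespace Summit.BirchSwinnertonDyer.BirchSwinnertonDyer.Theorems

open CongruenceSubgroup WeierstrassCurve NumberField IsDedekindDomain Field Rat.HeightOneSpectrum
  Literature.NumberTheory.EllipticCurves
  Literature.NumberTheory.EllipticCurves.ModularForms
  Literature.NumberTheory.Automorphic
  Literature.NumberTheory.EllipticCurves.Rank1Residual
  Literature.NumberTheory.EllipticCurves.Rank1Residual.Typed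
  Literature.NumberTheory.EllipticCurves.Wuthrich2014
  Literature.NumberTheory.EllipticCurves.SteinWuthrich2013
  Literature.NumberTheory.EllipticCurves.Greenberg1999
  Literature.NumberTheory.EllipticCurves.Kato2004
  Literature.NumberTheory.EllipticCurves.BarriosEtAl2025
  Literature.NumberTheory.EllipticCurves.EmertonPollackWeston2006
  Literature.NumberTheory.EllipticCurves.ShimuraCMFamily
  Literature.NumberTheory.GaloisRepresentations Literature.NumberTheory.GaloisCohomology
  Summit.BirchSwinnertonDyer.Rank1Residual
  Summit.BirchSwinnertonDyer.Rank1Residual.X11b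
  Summit.BirchSwinnertonDyer.Rank1Residual.X11b.Three.Koly

/-- **THE HYBRID GLUE (glue #17) — NO STRUCTURAL RESIDUAL.** As glue #16 (`…HybridChaKernel`) with the residual binder `hres3oneModOffGenusZero` (slot 7)
and the level-lowering pair `hLLOS` (slot 5, conjunct 3) DELETED: every multi-carrier corner pair is handled by
`NonSurjCorner.missingUpperBoundAt_of_savedDisplayD_of_twinLower_pAnchor` (parity datum + datum-free inert ∕ up-to-one roads on the twin-lower supply and
the saved display in D-form; p-anchor inside). Binders: `hZan` → 19948 → `hF3` → `hHida` → hMax → hShim5 → `hLabB6T` → `NonSurjCorner`. CONDITIONAL on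
every binder; 19065 NOT closed; nothing booked; T7.
[cite: PastenShimura2024, Prop. 6.13, Lemma 6.18] [cite: Jetchev2008, Thm. 1.1 and Cor. 1.5] [cite: Kato2004Asterisque, §17.13 (pp. 279–280)] [cite: Mazur1978, Cor. 4.1]
[cite: EmertonPollackWeston2006, Thm. 5.1.3] [cite: Miller2011LMS, Def. 1.1] [cite: Cha2005, Thm. 21 and Rmk. 25] [cite: JetchevSkinnerWan2017, §7.4.2] -/
theorem nonSurjCorner_of_kolyZShaAn_of_twinMuAn_of_fifteenFacts_of_hidaFacts_of_fiveNamedInputs_of_carrierLabelsB6_pAnchor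
    (hZan : ∀ (W : WeierstrassCurve ℚ) [W.IsElliptic] [W.IsGloballyMinimal] (p : ℕ) [Fact p.Prime]
      (N : ℕ) [NeZero N] (K : Type) [Field K] [NumberField K]
      (Dt : ModularParametrizationData W N) (β : ℤ) (ι : K →+* ℂ),
      ClassX11b W p → ¬ Surj W p → (p = 5 ∨ p = 7) → p ∣ padicValInt p W.minimalDiscriminantInt →
      ¬ Ram W p → (∃ s : ℚ, shaAn W = (s : ℂ) ∧ 0 < padicValRat p s) →
      W.conductorNorm ℤ = N → IsImaginaryQuadratic K →
      4 < (NumberField.discr K).natAbs → SatisfiesHeegnerHypothesis N K →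
      SatisfiesHeegnerHypothesis p K → (4 * (N : ℤ)) ∣ β ^ 2 - NumberField.discr K → ¬ (p : ℤ) ∣ Dt.c →
      (∃ (d₁ : KolyvaginHeegnerData Dt β ι 1) (y : (W.baseChange K).toAffine.Point),
        WeierstrassCurve.Affine.Point.map (W' := W) (algebraMap K (ringClassField K ι 1)).toRatAlgHom y =
          d₁.derivedPoint ∧
        ∃ Q : (W.baseChange K).toAffine.Point, ((p ^ (padicValNat p W.tamagawaProduct + 1) : ℕ) : ℤ) • Q = y) →
      ∃ M : ℕ, M ≤ padicValNat p W.tamagawaProduct ∧ CertificateAt Dt β ι p M)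
    (hμ : NonSurjCornerTwinMuAn)
    -- slot 3 (r14): FIFTEEN named facts — r11–r13's sixteen minus conjunct 16 (Cha 2005 Rmk. 25 upper, discharged inside on the corner)
    (hF3 :
      (∀ (N : ℕ) [NeZero N] (W : WeierstrassCurve ℚ) (K : Type) [Field K] [NumberField K], Literature.NumberTheory.EllipticCurves.gross_zagier N W K) ∧
      (∀ (N : ℕ) [NeZero N] (W : WeierstrassCurve ℚ) (K : Type) [Field K] [NumberField K], Literature.NumberTheory.EllipticCurves.kolyvagin N W K) ∧
      Literature.NumberTheory.EllipticCurves.Wuthrich2014.sha_dvd_analyticSha ∧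
      Literature.NumberTheory.EllipticCurves.rank_eq_analyticRank_of_analyticRank_le_one ∧
      Literature.NumberTheory.EllipticCurves.ModularForms.exists_isNewformOf ∧
      Literature.NumberTheory.EllipticCurves.friedbergHoffstein_exists_heegnerField_split_twist_ne_zero ∧
      Literature.NumberTheory.EllipticCurves.ModularForms.mazur_not_dvd_maninConstant_of_odd ∧
      Literature.NumberTheory.EllipticCurves.SteinWuthrich2013.thm61_splitMultiplicative ∧
      Literature.NumberTheory.EllipticCurves.SteinWuthrich2013.thm61_nonsplitMultiplicative ∧
      (∀ (W : WeierstrassCurve ℚ) [W.IsElliptic] [W.IsGloballyMinimal] (p : ℕ) [Fact p.Prime], Literature.NumberTheory.EllipticCurves.greenberg_stevens (W := W) (p := p)) ∧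
      Literature.NumberTheory.EllipticCurves.Cha2005.rmk25_pow_dvd_card_sha_primary_of_certificate ∧
      Literature.NumberTheory.EllipticCurves.Kato2004.thm12_4 ∧
      Literature.NumberTheory.EllipticCurves.Kato2004.exists_multDivisibilityInputs_nonsplit_contra ∧
      Literature.NumberTheory.EllipticCurves.Kato2004.exists_multDivisibilityInputs_split_contra ∧
      Literature.NumberTheory.EllipticCurves.Kato2004.exists_multDivisibilityInputs_fine_contra)
    -- slot 4 (r7): the six Hida-side NAMED facts of x11a's non-surjective chain
    (hHida : EmertonPollackWeston2006.thm311_cotorsion_weightK_member_ofLevel ∧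
      EmertonPollackWeston2006.thm1_muAlg_of_weightK_member_ofLevel ∧
      Wan2015.thm4_rational_weightK_member_of_bdd_ofLevel_irred ∧
      EmertonPollackWeston2006.thm513_transfer_from_weightK_member_of_bdd_ofLevel ∧
      DeligneSerre1974.thm61_exists_adicGaloisRep ∧ Hida2000_thm326_ordinary)
    (hMax : GrossLMS1991.prop37_2_frobeniusCongruence ∧
      (∀ (K : Type) [Field K] [NumberField K], poitouTate_selmerStructure_duality_conj K) ∧
      Gross1991_heegnerPoint_sub_ratTorsion_mem_E0_imageFree)
    -- slot 5, conjunct 2 (r12): FIVE named inputs of the Shimura roads — `shimuraCurve_heegnerSystem_primitivesSplitReduced` (the split-`p` road's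
    -- CM primitives) is IDLE once `2` may pair: the datum₂ lemma always places `p` in the inert set (`p ∤ p − 1`), so the split road is never taken
    (hShim5 : friedbergHoffstein_exists_twist_ne_zero_inertAt ∧ nonempty_shimuraParametrizationData ∧
      PastenShimura2024_componentOrders ∧
      (∀ (K : Type) [Field K] [NumberField K], casselsTate_levelInputs K) ∧
      shimuraCurve_heegnerSystem_primitivesFromFiveIrr)
    -- slot 6 (r10): the labelled CM family at the corner's inert frames with `d_K < −4`, WITH (B6) ONLY AT THE CARRIER PRIMES outside `S`
    (hLabB6T : ∀ (W : WeierstrassCurve ℚ) [W.IsElliptic] [W.IsGloballyMinimal] (p : ℕ) [Fact p.Prime],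
      ClassX11b W p → ¬ Surj W p → (p = 5 ∨ p = 7) →
      ∀ (N : ℕ) [NeZero N] (K : Type) [Field K] [NumberField K] (S : Finset ℕ) (Dt : ModularParametrizationData W N)
        (X : ShimuraCurveData (∏ q ∈ S, q) (N / ∏ q ∈ S, q)) (W' : WeierstrassCurve ℚ) [W'.IsElliptic]
        (P₀ : ShimuraParametrizationData X W'),
        W.conductorNorm ℤ = N → IsImaginaryQuadratic K → NumberField.discr K < -4 → Even S.card →
        (∀ ℓ ∈ S, ℓ.Prime ∧ ℓ ∣ N ∧ ¬ ℓ ^ 2 ∣ N ∧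
          ((Ideal.span {(ℓ : ℤ)}).primesOver (𝓞 K)).ncard = 1 ∧ ¬ (ℓ : ℤ) ∣ NumberField.discr K) →
        (∀ ℓ : ℕ, ℓ.Prime → ℓ ∣ N → ℓ ∉ S → ((Ideal.span {(ℓ : ℤ)}).primesOver (𝓞 K)).ncard = 2) →
        p ∈ S → ¬ (p : ℤ) ∣ Dt.c → P₀.IsMinimalFor W →
        ∃ (ι : K →+* ℂ) (y : (W.baseChange K).toAffine.Point) (degy : ℕ)
          (ys : (m : ℕ) → (W.baseChange (ringClassField K ι m)).toAffine.Point) (ε : ℤ), 0 < degy ∧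
          padicValNat p degy = padicValNat p P₀.deg ∧
          LDerivEK W K = 8 * (Real.pi : ℂ) ^ 2 * peterssonProduct (CongruenceSubgroup.Gamma0 N) 2 Dt.f Dt.f /
              ((((Units.torsionOrder K : ℝ) / 2) ^ 2 * √|(NumberField.discr K : ℝ)| : ℝ) : ℂ) *
            ((y.canonicalHeight : ℂ) / (degy : ℂ)) ∧
          (¬ IsOfFinAddOrder y → 0 < (AddSubgroup.zmultiples y).index) ∧
          ShimuraWalk.LabelsAt W N K ι y ys ε ∧
          ∀ (q : ℕ) [Fact q.Prime], q ∣ N → q ∉ S → p ∣ (W.baseChange ℚ_[q]).localTamagawaNumber ℤ_[q] → LabelB6 ι W N {q} ys) :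
    Summit.BirchSwinnertonDyer.BirchSwinnertonDyer.Theses.ErratumRoadFive.NonSurjCorner := by
  obtain ⟨hGZ, hKo, hWu, hGZK, hnf, hFHs, hMaz, hJs, hJn, hGS, hChaL, h12, hns', hsp', hfine'⟩ := hF3
  obtain ⟨h311, hT1a, hT2, hT1b, h61, h326⟩ := hHida
  obtain ⟨h37, hPTs, hF1⟩ := hMax
  obtain ⟨hFH, hJL, hCO, hCT, hLab⟩ := hShim5
  -- the seven former slot-3 conjuncts that are THEOREMS of the tree
  have hmod : hasEntireLFunction_rat := hasEntireLFunction_rat_of_exists_isNewformOf hnf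
  have hpar : nonempty_modularParametrizationData :=
    nonempty_modularParametrizationData_of_exists_isNewformOf hnf IsNewformOf.exists_maninConstant_ne_zero_holds
  have hrec : ∀ (N : ℕ) [NeZero N] (W : WeierstrassCurve ℚ) (K : Type) [Field K] [NumberField K],
      heegnerPointOfConductor_one_galoisConj N W K :=
    fun N _ W K _ _ ↦ heegnerPointOfConductor_one_galoisConj_holds N W K
  have hD36 : ∀ (N : ℕ) [NeZero N] (W : WeierstrassCurve ℚ) (K : Type) [Field K] [NumberField K],
      phi_heegnerTau_mem_singularModuliField N W K :=
    fun N _ W K _ _ ↦ phi_heegnerTau_mem_singularModuliField_holds N W K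
  have hPT : ∀ (K : Type) [Field K] [NumberField K],
      Literature.NumberTheory.GaloisCohomology.poitouTate_sum_localTatePairing_eq_zero K :=
    poitouTate_sum_localTatePairing_eq_zero_holds
  have hBR : localTamagawaNumber_quadraticTwist_two_mem_of_goodReduction :=
    BarriosEtAl2025.localTamagawaNumber_quadraticTwist_two_mem_of_goodReduction_holds
  -- slot 4: the leaf-twin lower half from 19948 + named facts (the `_of_mazur` Hida doors: no Greenberg 1.5, no Cor. 18)
  have h₄ℓ : ∀ (Wd : WeierstrassCurve ℚ) [Wd.IsElliptic] [Wd.IsGloballyMinimal] (p : ℕ) [Fact p.Prime],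
      ClassX11a Wd p → ¬ Surj Wd p → (p = 5 ∨ p = 7) → p ∣ padicValInt p Wd.minimalDiscriminantInt →
      ¬ X11a.ShaAnUnit Wd p → Typed.MissingLowerBoundAt Wd p :=
    fun Wd _ _ p _ hXa hnsd h57 _ _ ↦
      NonSurjChain.lowerNonSurj_fiveSeven_of_nonSurjCornerTwinMuAn_of_contraFacts_of_mazur hnf h311 hT1a hT2 hT1b h61 h326 h12 hns'
        hsp' hfine' hMaz hJs hJn hGZK hGS hμ Wd p hXa hnsd h57
  -- slot 6 (r10): the SAVED display in D-form at every corner pair and every `q₁`, from the labels with (B6) at the CARRIERS, Poitou–Tate and CT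
  have hSavD : ∀ (W : WeierstrassCurve ℚ) [W.IsElliptic] [W.IsGloballyMinimal] (p : ℕ) [Fact p.Prime],
      ClassX11b W p → ¬ Surj W p → (p = 5 ∨ p = 7) → ∀ (q₁ : ℕ) [Fact q₁.Prime], ShimuraInertSavedDisplayAtD W p q₁ :=
    NonSurjCorner.shimuraInertSavedDisplayAtD_of_carrierLabelsB6 hPTs hCT hLabB6T
  exact X11b.erratumRoadFive_nonSurjCorner_of_kolyZShaAn_of_kolyJMax_of_multiUpper_of_lowerLeafTwinDeep_of_twinMultDivisibility_of_casselsTate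
    hGZ hKo hWu hGZK hmod hnf hpar hFHs hMaz hrec hD36 hJs hJn hGS hChaL hCT h37 h₄ℓ hZan
    (X11b.Three.Koly.nonSurjCornerKolyJ_max_of_threeNamedFacts h37 hPTs hF1)
    (fun W _ _ p _ hX hns' h57 hv hnr htam hmulti ↦
      -- EVERY multi-carrier pair: parity datum + datum-free roads (p-anchor); the TWIN-LOWER SUPPLY from FH + the leaf-twin lower half
      NonSurjCorner.missingUpperBoundAt_of_savedDisplayD_of_twinLower_pAnchor hGZK hmod hnf hMaz hBR hJL hCO hPT hCT hLab W p hX hns'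
        h57 htam hmulti (NonSurjCorner.fhTwinLowerSupplyAt_of_lowerLeafTwinDeep hGZK hmod hnf hFH h₄ℓ W p hX hns' h57 hv hnr)
        (fun q₁ _ ↦ hSavD W p hX hns' h57 q₁))
    (fun Wd _ _ p _ hXa hnsd h57 hvd ↦
      X11b.multDivisibilityAt_of_katoFacts_of_muAn_contra_of_mazur Kato2004.nonempty_iwasawaH1Data_holds h12 hnf hns' hsp' hfine'
        hMaz Wd p hXa.2.1 hXa.2.2.1 hXa.2.2.2.1 hnsd (fun f hf ϖ hϖ a L hsa hna hL ↦ hμ Wd p hXa hnsd h57 hvd f hf ϖ hϖ a L hsa hna hL))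

end Summit.BirchSwinnertonDyer.BirchSwinnertonDyer.Theorems

end
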